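import Mathlib
import HarnessLib

/-!
# `NoHeavyLowerTail` (stmt-CriticalPhenomena-4575) — hair AM–GM: the analytic core of Step 2 of the supply proofs (MWF-CERT §5)

Support file (prover `prim-gen-swap` gen 9; `--supports stmt-CriticalPhenomena-4575`).  No definitions, no named facts, no sorries.

Step 2 of the proof of the supply inequality U0' (seat memo MWF-CERT.md §5) charges a second-order term `θ_i θ_j` (stars `i`, `j` of two
adjacent classes) to the two three-hair words `π₁ = (i→q, j→s, n→p)`, `π₂ = (i→p, j→q, n→v)`, whose extreme coefficients use BOTH hairs of
each of the three stars.  The elementary inequalities behind "`π₁ + π₂ ≥ 8 θ_i θ_j`" are collected here, in the exact coefficient form of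
`StarSet.extreme_regroup` (`a(k)`, `k : Fin 3`, hairs `β, β' ∈ [0,1]`, `θ = ββ'`):

* `StarSet.extremeCoeff_one_mul_two` — `a(1)·a(2)·(1 − √θ)² ≥ a(0)²·θ` (AM–GM `β + β' ≥ 2√θ`), i.e. `√(a(1)a(2)) ≥ a(0)·√θ/(1−√θ)`;
* `StarSet.four_sqrt_mul_le` — `4√x(1 − √x) ≤ 1`;
* `StarSet.sqrt_classWeight_le_sum_sqrt` — `√(1 − Π_n (1−θ_n)) ≤ Σ_n √θ_n` (the third class of the pattern supplies `√Θ_N`);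
* `StarSet.two_word_amgm` — `u₁u₂u₃ + v₁v₂v₃ ≥ 2·√(u₁v₁)·√(u₂v₂)·√(u₃v₃)` for nonnegative reals (AM–GM for the two words).
-/

namespace Summit.CriticalPhenomena.PercolationContinuityZ3.Theorems

open Finset
open scoped BigOperators

namespace StarSet

/-- **Both hairs of a star: `a(1)a(2)(1−√θ)² ≥ a(0)²θ`.**  Here `a(k)` are the extreme coefficients of `StarSet.extreme_regroup`. [folklore; MWF-CERT.md §5] -/
theorem extremeCoeff_one_mul_two (β β' : ℝ) (hβ0 : 0 ≤ β) (hβ1 : β ≤ 1) (hβ'0 : 0 ≤ β') (hβ'1 : β' ≤ 1) :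
    (if β * β' < 1 then ((1 - β) * (1 - β')) / (1 - β * β') else (0 : ℝ)) ^ 2 * (β * β') ≤
      ((if β * β' < 1 then (β * (1 - β')) / (1 - β * β') else (1 : ℝ)) *
        (if β * β' < 1 then ((1 - β) * β') / (1 - β * β') else (0 : ℝ))) * (1 - Real.sqrt (β * β')) ^ 2 := by
  have hθ0 : 0 ≤ β * β' := mul_nonneg hβ0 hβ'0
  have hs0 : 0 ≤ Real.sqrt (β * β') := Real.sqrt_nonneg _
  have hs2 : Real.sqrt (β * β') ^ 2 = β * β' := Real.sq_sqrt hθ0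
  -- AM–GM: `(1−β)(1−β') ≤ (1 − √θ)²`
  have hamgm : (1 - β) * (1 - β') ≤ (1 - Real.sqrt (β * β')) ^ 2 := by
    have hsq : Real.sqrt (β * β') = Real.sqrt β * Real.sqrt β' := Real.sqrt_mul hβ0 β'
    have hb : Real.sqrt β ^ 2 = β := Real.sq_sqrt hβ0
    have hb' : Real.sqrt β' ^ 2 = β' := Real.sq_sqrt hβ'0
    nlinarith [sq_nonneg (Real.sqrt β - Real.sqrt β'), Real.sqrt_nonneg β, Real.sqrt_nonneg β']
  by_cases h : β * β' < 1
  · rw [if_pos h, if_pos h, if_pos h]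
    have hd : 0 < 1 - β * β' := by linarith
    rw [div_pow, div_mul_div_comm]
    rw [div_mul_eq_mul_div, div_mul_eq_mul_div, div_le_div_iff₀ (pow_pos hd 2) (by positivity)]
    have hnn : 0 ≤ (1 - β) * (1 - β') := mul_nonneg (by linarith) (by linarith)
    have hkey : ((1 - β) * (1 - β')) ^ 2 * (β * β') ≤ (β * (1 - β')) * ((1 - β) * β') * (1 - Real.sqrt (β * β')) ^ 2 := by
      have : ((1 - β) * (1 - β')) ^ 2 * (β * β') = (β * (1 - β')) * ((1 - β) * β') * ((1 - β) * (1 - β')) := by ring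
      rw [this]
      exact mul_le_mul_of_nonneg_left hamgm (by nlinarith)
    calc ((1 - β) * (1 - β')) ^ 2 * (β * β') * ((1 - β * β') * (1 - β * β'))
        = (((1 - β) * (1 - β')) ^ 2 * (β * β')) * (1 - β * β') ^ 2 := by ring
      _ ≤ ((β * (1 - β')) * ((1 - β) * β') * (1 - Real.sqrt (β * β')) ^ 2) * (1 - β * β') ^ 2 :=
          mul_le_mul_of_nonneg_right hkey (sq_nonneg _)
      _ = β * (1 - β') * ((1 - β) * β') * (1 - Real.sqrt (β * β')) ^ 2 * (1 - β * β') ^ 2 := by ring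
  · rw [if_neg h, if_neg h, if_neg h]
    simp

/-- `4√x(1−√x) ≤ 1`. [folklore] -/
theorem four_sqrt_mul_le (x : ℝ) : 4 * Real.sqrt x * (1 - Real.sqrt x) ≤ 1 := by
  nlinarith [sq_nonneg (2 * Real.sqrt x - 1)]

/-- **The class weight under the square root: `√(1 − Π_n(1−θ_n)) ≤ Σ_n √θ_n`** for `θ ∈ [0,1]^N`. [folklore] -/
theorem sqrt_classWeight_le_sum_sqrt {ι : Type*} (N : Finset ι) (θ : ι → ℝ) (hθ0 : ∀ n, 0 ≤ θ n) (hθ1 : ∀ n, θ n ≤ 1) :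
    Real.sqrt (1 - ∏ n ∈ N, (1 - θ n)) ≤ ∑ n ∈ N, Real.sqrt (θ n) := by
  classical
  induction N using Finset.induction_on with
  | empty => simp
  | @insert a s ha ih =>
    rw [prod_insert ha, sum_insert ha]
    have hP0 : 0 ≤ ∏ n ∈ s, (1 - θ n) := prod_nonneg fun n _ => sub_nonneg.2 (hθ1 n)
    have hP1 : ∏ n ∈ s, (1 - θ n) ≤ 1 := prod_le_one (fun n _ => sub_nonneg.2 (hθ1 n)) fun n _ => sub_le_self _ (hθ0 n)
    -- `1 − (1−θ_a)P ≤ θ_a + (1 − P)` and `√(x + y) ≤ √x + √y`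
    have hle : 1 - (1 - θ a) * ∏ n ∈ s, (1 - θ n) ≤ θ a + (1 - ∏ n ∈ s, (1 - θ n)) := by nlinarith [hθ0 a]
    have hx : 0 ≤ θ a := hθ0 a
    have hy : 0 ≤ 1 - ∏ n ∈ s, (1 - θ n) := sub_nonneg.2 hP1
    calc Real.sqrt (1 - (1 - θ a) * ∏ n ∈ s, (1 - θ n))
        ≤ Real.sqrt (θ a + (1 - ∏ n ∈ s, (1 - θ n))) := Real.sqrt_le_sqrt hle
      _ ≤ Real.sqrt (θ a) + Real.sqrt (1 - ∏ n ∈ s, (1 - θ n)) := by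
          have hsum : θ a + (1 - ∏ n ∈ s, (1 - θ n)) ≤
              (Real.sqrt (θ a) + Real.sqrt (1 - ∏ n ∈ s, (1 - θ n))) ^ 2 := by
            nlinarith [Real.sq_sqrt hx, Real.sq_sqrt hy, Real.sqrt_nonneg (θ a),
              Real.sqrt_nonneg (1 - ∏ n ∈ s, (1 - θ n))]
          calc Real.sqrt (θ a + (1 - ∏ n ∈ s, (1 - θ n)))
              ≤ Real.sqrt ((Real.sqrt (θ a) + Real.sqrt (1 - ∏ n ∈ s, (1 - θ n))) ^ 2) := Real.sqrt_le_sqrt hsum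
            _ = Real.sqrt (θ a) + Real.sqrt (1 - ∏ n ∈ s, (1 - θ n)) :=
                Real.sqrt_sq (add_nonneg (Real.sqrt_nonneg _) (Real.sqrt_nonneg _))
      _ ≤ Real.sqrt (θ a) + ∑ n ∈ s, Real.sqrt (θ n) := add_le_add le_rfl ih

/-- **AM–GM for the two words.**  `u₁u₂u₃ + v₁v₂v₃ ≥ 2√(u₁v₁)√(u₂v₂)√(u₃v₃)` for nonnegative reals. [folklore] -/
theorem two_word_amgm (u₁ u₂ u₃ v₁ v₂ v₃ : ℝ) (hu₁ : 0 ≤ u₁) (hu₂ : 0 ≤ u₂) (hu₃ : 0 ≤ u₃)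
    (hv₁ : 0 ≤ v₁) (hv₂ : 0 ≤ v₂) (hv₃ : 0 ≤ v₃) :
    2 * (Real.sqrt (u₁ * v₁) * Real.sqrt (u₂ * v₂) * Real.sqrt (u₃ * v₃)) ≤ u₁ * u₂ * u₃ + v₁ * v₂ * v₃ := by
  have hA : 0 ≤ u₁ * u₂ * u₃ := by positivity
  have hB : 0 ≤ v₁ * v₂ * v₃ := by positivity
  have hprod : Real.sqrt (u₁ * v₁) * Real.sqrt (u₂ * v₂) * Real.sqrt (u₃ * v₃) =
      Real.sqrt ((u₁ * u₂ * u₃) * (v₁ * v₂ * v₃)) := by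
    rw [← Real.sqrt_mul (mul_nonneg hu₁ hv₁), ← Real.sqrt_mul (by positivity)]
    congr 1; ring
  rw [hprod, Real.sqrt_mul hA]
  nlinarith [sq_nonneg (Real.sqrt (u₁ * u₂ * u₃) - Real.sqrt (v₁ * v₂ * v₃)), Real.sq_sqrt hA, Real.sq_sqrt hB]

/-- **The pair inequality of Step 2.**  If the third class supplies `S ≥ √θ_i` (e.g. `S = Σ_n √θ_n ≥ √Θ_N ≥ √Θ_κ ≥ √θ_i` on the fundamental
cycle of a maximum-weight forest), then `8 θ_i θ_j ≤ 2 · (√θ_i/(1−√θ_i)) · (√θ_j/(1−√θ_j)) · S` for `θ_i, θ_j ∈ [0,1)`. [MWF-CERT.md §5 Step 2] -/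
theorem pair_charge_le (θi θj S : ℝ) (hi0 : 0 ≤ θi) (hi1 : θi < 1) (hj0 : 0 ≤ θj) (hj1 : θj < 1) (hS : Real.sqrt θi ≤ S) :
    8 * θi * θj ≤ 2 * (Real.sqrt θi / (1 - Real.sqrt θi)) * (Real.sqrt θj / (1 - Real.sqrt θj)) * S := by
  have hsi : Real.sqrt θi < 1 := by rw [Real.sqrt_lt' one_pos]; simpa using hi1
  have hsj : Real.sqrt θj < 1 := by rw [Real.sqrt_lt' one_pos]; simpa using hj1
  have hsi0 : 0 ≤ Real.sqrt θi := Real.sqrt_nonneg _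
  have hsj0 : 0 ≤ Real.sqrt θj := Real.sqrt_nonneg _
  have hdi : 0 < 1 - Real.sqrt θi := by linarith
  have hdj : 0 < 1 - Real.sqrt θj := by linarith
  -- `√θ/(1−√θ) ≥ √θ` and `√θ_j/(1−√θ_j) ≥ 4 θ_j`
  have h1 : Real.sqrt θi ≤ Real.sqrt θi / (1 - Real.sqrt θi) := by
    rw [le_div_iff₀ hdi]; nlinarith
  have h2 : 4 * θj ≤ Real.sqrt θj / (1 - Real.sqrt θj) := by
    rw [le_div_iff₀ hdj]
    have := four_sqrt_mul_le θj
    nlinarith [Real.sq_sqrt hj0]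
  have hθi : θi = Real.sqrt θi * Real.sqrt θi := (Real.mul_self_sqrt hi0).symm
  calc 8 * θi * θj = 2 * (Real.sqrt θi * (4 * θj)) * Real.sqrt θi := by linear_combination (8 * θj) * hθi
    _ ≤ 2 * (Real.sqrt θi / (1 - Real.sqrt θi) * (Real.sqrt θj / (1 - Real.sqrt θj))) * S := by
        have ha : Real.sqrt θi * (4 * θj) ≤ Real.sqrt θi / (1 - Real.sqrt θi) * (Real.sqrt θj / (1 - Real.sqrt θj)) :=
          mul_le_mul h1 h2 (by positivity) (div_nonneg hsi0 hdi.le)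
        have hb : 0 ≤ Real.sqrt θi / (1 - Real.sqrt θi) * (Real.sqrt θj / (1 - Real.sqrt θj)) :=
          mul_nonneg (div_nonneg hsi0 hdi.le) (div_nonneg hsj0 hdj.le)
        nlinarith [mul_le_mul ha hS hsi0 hb]
    _ = 2 * (Real.sqrt θi / (1 - Real.sqrt θi)) * (Real.sqrt θj / (1 - Real.sqrt θj)) * S := by ring

end StarSet

end Summit.CriticalPhenomena.PercolationContinuityZ3.Theorems
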